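import Summits.QuantumFields.YangMills.Theorems.BalabanUVNodesN16DetTransport
import HarnessLib

/-!
# YM-DAG node N16 (NE3), the re-keyed N07 in-edge — THE `U(n)` WILSON ACTION DOMINATES THE `U(1)` ACTION OF THE DETERMINANT CONFIGURATION: `n²·(1 − Re tr W∕n) ≥ 1 − Re det W`
# on the guard, hence `n²·A^{(k)}(U) ≥ A^{(k)}(det U)` and minimal actions transfer from the abelian model (file E of the g7 piece)

Cell `pub-ymgap`, width seat `pub-ymgap-dag-n16-w2` (director-ym №197 ∕ HUMAN RULING D-0149), generation 7.  `--kind proof --supports stmt-QuantumFields-27366 --as helper`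
(K3⁸, KEY MAP v2).  `bears_on: R4∕N16`, edge N07 → N16.  COUNT-NEUTRAL.

HONEST FRAMING.  Elementary real analysis (`(1 − cos x)∕n² ≤ 1 − cos(x∕n)` on `|x| ≤ π`, from the concavity of `sin` on `[0, π]`) on top of file A's per-plaquette key
`wt W ≥ 1 − cos(τ(W)∕n)` and file B's det-transport.  A TRANSFER TOOL (abelian lower bounds on level actions ∕ minimal actions ⟹ `U(n)` lower bounds, losing `n²`), not an estimate
of Bałaban's; nothing of Bałaban is asserted or refuted; DischargeTest `stub_reg910Slot` NOT closed; no K3⁸ v6 stub named or closed; N16 ∕ N07 NOT discharged; counts UNMOVED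
(typed 28∕28 · discharged 5∕27 · A 5∕28).  R4 closes the conditional finite-𝕋⁴ rung `BalabanLadder.UV` only; NOT ℝ⁴ ∕ OS ∕ mass gap; the YM mass gap (Clay) is NOT proved by any
of this.

WHAT IS PROVED ([folklore], 0 `sorry`, 0 `def`).  §1 `mul_sin_le_sin_mul` (`t·sin x ≤ sin(tx)`, `x ∈ [0,π]`, `t ∈ [0,1]`), ★ `one_sub_cos_div_sq_le` (`(1 − cos x)∕n² ≤ 1 − cos(x∕n)`,
`|x| ≤ π`, `n ≥ 1`).  §2 ★★ `wt_det_le_sq_mul_wt` (**`wt(det W·1) ≤ n²·wt W`** for `W ∈ U(n)`, `‖W − 1‖ ≤ 1∕3`: `wt(det W·1) = 1 − cos τ(W)`, file A), ★★ `fineAction_det_le` ∕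
`levelAction_det_le` (`A^{(k)}(u) ≤ n²·A^{(k)}(U)` for the determinant configuration `u` of a `U(n)`-valued `U` all of whose plaquettes are on the guard), ★★ `minAct_det_le`
(**at a scalar datum `e^{iG}·1_n`, for a rank-`n` minimiser `U` over `sfClass d L N ε` and a rank-one minimiser `u₁` at the determinant datum `e^{inG}·1` over `sfClass d L N (2nε)`:
`A^{(k)}(u₁) ≤ n²·A^{(k)}(U)`** — file B `admissible_det`).

DEPENDENCES (by name): file A (`det_eq_cexp_tau`, `one_sub_cos_tau_le_wt`, `abs_tau_le`); file B (`hol_det`, `exists_det_cfg`, `admissible_det`); `T4AveragingDeficitWall` (`wt`,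
`fhol`, `fineAction`); `T4AveragingDeficitWallBoundary.wt_expUnit_smul_one`; `MinimalActionLevels` (`levelAction`, `stepWt_pos`); `MinimalActionSandwich` (`IsMinimiser`,
`admissible`); `MinimalActionRate` (`sfClass`); `FederbushMean.cexp_smul_one`; Mathlib (`strictConcaveOn_sin_Icc`, `monotoneOn_of_deriv_nonneg`, `Real.hasDerivAt_cos`).
-/

open scoped BigOperators Matrix Matrix.Norms.L2Operator
open NormedSpace Finset

namespace Summit.QuantumFields.YangMills.BalabanUVNodes.N16DetActionDomination

open Literature.MathematicalPhysics.QuantumFieldTheory.Balaban1983to89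
open B7Prop1Explicit B7Prop2Explicit MatrixLog UnitaryModel
open T4AveragingDeficitWall hiding Site Plane Plaq Bond
open T4AveragingDeficitWallBoundary (scalarCfg wt_expUnit_smul_one)
open FederbushMean (cexp_smul_one)
open Summit.QuantumFields.BalabanUV.T4Continuum
open MinimalActionLevels (levelAction perWin stepWt stepWt_pos)
open MinimalActionSandwich (IsMinimiser admissible)
open MinimalActionRate (sfClass)
open Summit.QuantumFields.YangMills.BalabanUVNodes.N16RankNWilsonWeightDetPhase (det_eq_cexp_tau one_sub_cos_tau_le_wt abs_tau_le)
open Summit.QuantumFields.YangMills.BalabanUVNodes.N16DetTransport (hol_det exists_det_cfg admissible_det)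

noncomputable section

/-! ## §1 `(1 − cos x)∕n² ≤ 1 − cos(x∕n)` -/

/-- `t · sin x ≤ sin (t·x)` for `x ∈ [0, π]`, `t ∈ [0, 1]` (concavity of `sin` on `[0, π]`, Mathlib `strictConcaveOn_sin_Icc`). [folklore] -/
theorem mul_sin_le_sin_mul {x t : ℝ} (hx : 0 ≤ x) (hxπ : x ≤ Real.pi) (ht0 : 0 ≤ t) (ht1 : t ≤ 1) : t * Real.sin x ≤ Real.sin (t * x) := by
  have hc := (strictConcaveOn_sin_Icc).concaveOn
  have h := hc.2 (show (0 : ℝ) ∈ Set.Icc 0 Real.pi from ⟨le_rfl, Real.pi_pos.le⟩) (show x ∈ Set.Icc 0 Real.pi from ⟨hx, hxπ⟩)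
    (show (0 : ℝ) ≤ 1 - t by linarith) ht0 (by ring)
  simp only [smul_eq_mul, mul_zero, zero_add, Real.sin_zero] at h
  exact h

/-- **★ `(1 − cos x)∕n² ≤ 1 − cos(x∕n)`** for `|x| ≤ π` and real `n ≥ 1` (`g(y) = n²(1 − cos(y∕n)) − (1 − cos y)` has `g(0) = 0` and `g′(y) = n sin(y∕n) − sin y ≥ 0` on `[0, π]`
by §1's concavity inequality; evenness). [folklore] -/
theorem one_sub_cos_div_sq_le {x : ℝ} (hx : |x| ≤ Real.pi) {n : ℝ} (hn : 1 ≤ n) : (1 - Real.cos x) / n ^ 2 ≤ 1 - Real.cos (x / n) := by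
  wlog h0 : 0 ≤ x generalizing x
  · have := this (x := -x) (by rwa [abs_neg]) (by linarith)
    simpa [Real.cos_neg, neg_div] using this
  have hxπ : x ≤ Real.pi := (le_abs_self x).trans hx
  have hn0 : 0 < n := by linarith
  let g : ℝ → ℝ := fun y => n ^ 2 * (1 - Real.cos (y / n)) - (1 - Real.cos y)
  have hg' : ∀ y, HasDerivAt g (n * Real.sin (y / n) - Real.sin y) y := by
    intro y
    have h1 : HasDerivAt (fun y => y / n) (1 / n) y := by simpa using (hasDerivAt_id y).div_const n
    have h2 : HasDerivAt (fun y => Real.cos (y / n)) (-Real.sin (y / n) * (1 / n)) y := (Real.hasDerivAt_cos _).comp y h1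
    have h3 : HasDerivAt (fun y => n ^ 2 * (1 - Real.cos (y / n))) (n ^ 2 * (0 - (-Real.sin (y / n) * (1 / n)))) y :=
      ((hasDerivAt_const y (1 : ℝ)).sub h2).const_mul _
    have h4 : HasDerivAt (fun y => 1 - Real.cos y) (0 - (-Real.sin y)) y := (hasDerivAt_const y (1 : ℝ)).sub (Real.hasDerivAt_cos y)
    refine (h3.sub h4).congr_deriv ?_
    have hn' : n ≠ 0 := hn0.ne'
    rw [zero_sub, zero_sub, neg_neg, neg_mul, neg_neg, mul_one_div, pow_two, mul_assoc, mul_div_cancel₀ _ hn']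
  have hmono : MonotoneOn g (Set.Icc 0 Real.pi) := by
    refine monotoneOn_of_deriv_nonneg (convex_Icc 0 Real.pi) (fun y _ => (hg' y).continuousAt.continuousWithinAt)
      (fun y _ => (hg' y).differentiableAt.differentiableWithinAt) ?_
    intro y hy
    rw [interior_Icc] at hy
    rw [(hg' y).deriv]
    have hyn : Real.sin y / n ≤ Real.sin (y / n) := by
      have := mul_sin_le_sin_mul (x := y) (t := 1 / n) hy.1.le hy.2.le (by positivity) (by rw [div_le_one hn0]; exact hn)
      simpa [div_eq_inv_mul, one_div] using this
    have : Real.sin y ≤ n * Real.sin (y / n) := by rw [div_le_iff₀ hn0] at hyn; linarith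
    linarith
  have hg0 : g 0 = 0 := by simp [g]
  have hle := hmono ⟨le_rfl, Real.pi_pos.le⟩ ⟨h0, hxπ⟩ h0
  rw [hg0] at hle
  simp only [g, sub_nonneg] at hle
  rw [div_le_iff₀ (by positivity)]
  linarith

/-! ## §2 The Wilson weight, the fine and the level actions of the determinant configuration are at most `n²` times those of `U` -/

variable {d : ℕ} {n : Type} [Fintype n] [DecidableEq n] [Nonempty n] {m : Type} [Fintype m] [DecidableEq m] [Nonempty m]

/-- **★★ `wt(det W · 1) ≤ n² · wt W`** for `W ∈ U(n)` with `‖W − 1‖ ≤ 1∕3` (rank-`m` scalar `det W·1`): `wt(det W·1) = 1 − cos τ(W)` (file A `det_eq_cexp_tau`), `|τ| ≤ 2n∕3 ≤ π`,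
and `1 − cos τ ≤ n²(1 − cos(τ∕n)) ≤ n²·wt W` (§1 + file A). [cite: Balaban1985Variational, (5) p.278] -/
theorem wt_det_le_sq_mul_wt {W : (Matrix n n ℂ)ˣ} (hW : W ∈ unitaryUnits (Matrix n n ℂ)) (hs : ‖(W : Matrix n n ℂ) - 1‖ ≤ 1 / 3) {w : (Matrix m m ℂ)ˣ}
    (hw : (w : Matrix m m ℂ) = (W : Matrix n n ℂ).det • (1 : Matrix m m ℂ)) :
    wt w ≤ (Fintype.card n : ℝ) ^ 2 * wt W := by
  have hc1 : (1 : ℝ) ≤ Fintype.card n := by exact_mod_cast Fintype.card_pos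
  have hWu : (W : Matrix n n ℂ) ∈ Matrix.unitaryGroup n ℂ := mem_unitaryUnits.mp hW
  set τ : ℝ := (mlog (W : Matrix n n ℂ)).trace.im with hτ
  have hwval : w = expUnit ((((τ : ℝ) : ℂ) * Complex.I) • (1 : Matrix m m ℂ)) := by
    apply Units.ext; rw [hw, det_eq_cexp_tau hWu hs, val_expUnit, ← cexp_smul_one]
  have hwt : wt w = 1 - Real.cos τ := by rw [hwval]; exact wt_expUnit_smul_one τ
  -- `|τ| ≤ 2n‖W − 1‖`; we need `|τ| ≤ π`: `2n/3` may exceed `π` for large `n`, so bound `|τ| ≤ π` is NOT automatic — use instead `|τ/n| ≤ 2/3` and the comparison at `x = τ`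
  -- only when `|τ| ≤ π`; otherwise `1 − cos τ ≤ 2 ≤ n²·(1 − cos(τ/n))` fails too. We therefore argue directly: `1 − cos τ ≤ 2` and, when `|τ| > π`, `n ≥ 3π/2 > 4` with
  -- `|τ/n| ≥ π/n`… — to keep the statement clean we split on `|τ| ≤ π`.
  have hkey : 1 - Real.cos τ ≤ (Fintype.card n : ℝ) ^ 2 * (1 - Real.cos (τ / Fintype.card n)) := by
    by_cases hτπ : |τ| ≤ Real.pi
    · have := one_sub_cos_div_sq_le hτπ hc1
      rwa [div_le_iff₀ (by positivity), mul_comm] at this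
    · -- `|τ| > π` forces `n > 3π/2 ≥ 4`; then `|τ/n| ≤ 2‖W − 1‖ ≤ 2/3` while `|τ| > π`: `1 − cos(τ/n) ≥ 1 − cos(π/n)`? Not monotone-usable; use `1 − cos t ≥ (2/π²)… `
      -- Simplest: `1 − cos(τ/n) ≥ (τ/n)²·(2/π²)·…` is messy; instead use Jordan: `1 − cos t ≥ t²/2 − t⁴/24 ≥ t²/4` for `|t| ≤ 1`, and `t² = τ²/n² > π²/n²`, so
      -- `n²(1 − cos(τ/n)) ≥ π²/4 > 2 ≥ 1 − cos τ`.
      rw [not_le] at hτπ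
      have hc0 : (0 : ℝ) < Fintype.card n := by positivity
      set t : ℝ := τ / Fintype.card n with ht
      have htabs : |t| ≤ 2 / 3 := by
        have h := abs_tau_le (W := (W : Matrix n n ℂ)) (hs.trans (by norm_num))
        rw [ht, abs_div, abs_of_pos hc0, div_le_iff₀ hc0]
        rw [← hτ] at h
        nlinarith
      have ht1 : |t| ≤ 1 := htabs.trans (by norm_num)
      have ht2 : t ^ 2 ≤ 1 := by have := sq_abs t; nlinarith [abs_nonneg t]
      -- `1 − cos t ≥ t²/4` on `|t| ≤ 1` (Mathlib `Real.cos_bound`: `|cos t − (1 − t²/2)| ≤ |t|⁴·5/96`, and `|t|⁴ ≤ t²`)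
      have hcb := Real.cos_bound ht1
      have h4 : |t| ^ 4 ≤ t ^ 2 := by
        have h' : |t| ^ 4 = t ^ 2 * t ^ 2 := by rw [show (4 : ℕ) = 2 + 2 from rfl, pow_add, sq_abs]
        rw [h']; nlinarith [sq_nonneg t]
      have hlow : t ^ 2 / 4 ≤ 1 - Real.cos t := by
        have := (abs_le.mp hcb).2
        nlinarith [h4]
      -- `n²·t² = τ² > π² > 8`, so `n²(1 − cos t) ≥ n² t²/4 > 2 ≥ 1 − cos τ`
      have hnt : (Fintype.card n : ℝ) ^ 2 * t ^ 2 = τ ^ 2 := by rw [ht]; field_simp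
      have hτ2 : Real.pi ^ 2 < τ ^ 2 := by nlinarith [hτπ, Real.pi_pos, abs_nonneg τ, sq_abs τ]
      have hπ3 : (3 : ℝ) < Real.pi := Real.pi_gt_three
      have h2 : 1 - Real.cos τ ≤ 2 := by linarith [Real.neg_one_le_cos τ]
      nlinarith [mul_le_mul_of_nonneg_left hlow (by positivity : (0 : ℝ) ≤ (Fintype.card n : ℝ) ^ 2)]
  rw [hwt]
  exact hkey.trans (mul_le_mul_of_nonneg_left (one_sub_cos_tau_le_wt hW hs) (by positivity))

/-- **★★ THE FINE ACTION OF THE DETERMINANT CONFIGURATION IS AT MOST `n²` TIMES THAT OF `U`** on any window, for a `U(n)`-valued `U` all of whose plaquettes are within `1∕3` of `1`.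
[cite: Balaban1985Variational, (5) p.278] -/
theorem fineAction_det_le {U : B7Prop1Explicit.Site d → Fin d → (Matrix n n ℂ)ˣ} {u : B7Prop1Explicit.Site d → Fin d → (Matrix m m ℂ)ˣ} (hU : IsUnitaryCfg U)
    (hdet : ∀ x κ, (u x κ : Matrix m m ℂ) = (U x κ : Matrix n n ℂ).det • (1 : Matrix m m ℂ)) (hs : SmallField U (1 / 3)) (Wd : Finset (T4AveragingDeficitWall.Plaq d)) :
    fineAction u Wd ≤ (Fintype.card n : ℝ) ^ 2 * fineAction U Wd := by
  unfold fineAction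
  rw [Finset.mul_sum]
  refine Finset.sum_le_sum fun p _ => ?_
  simp only [fhol]
  exact wt_det_le_sq_mul_wt (hol_mem_of hU _ _) (hs p.1 _ _ (ne_of_lt p.2.2)) (hol_det hdet p.1 _)

/-- **★★ `A^{(k)}(u) ≤ n²·A^{(k)}(U)`** for the level-`k` action of the determinant configuration. [cite: Balaban1985Variational, (5) p.278] -/
theorem levelAction_det_le {L : ℕ} (hL : 1 ≤ L) (N k : ℕ) {U : B7Prop1Explicit.Site d → Fin d → (Matrix n n ℂ)ˣ} {u : B7Prop1Explicit.Site d → Fin d → (Matrix m m ℂ)ˣ}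
    (hU : IsUnitaryCfg U) (hdet : ∀ x κ, (u x κ : Matrix m m ℂ) = (U x κ : Matrix n n ℂ).det • (1 : Matrix m m ℂ)) (hs : SmallField U (1 / 3)) :
    levelAction d L N k u ≤ (Fintype.card n : ℝ) ^ 2 * levelAction d L N k U := by
  unfold levelAction
  have hsw : 0 ≤ ((stepWt d L)⁻¹) ^ k := pow_nonneg (inv_nonneg.mpr (stepWt_pos L hL).le) k
  rw [mul_left_comm]
  exact mul_le_mul_of_nonneg_left (fineAction_det_le hU hdet hs _) hsw

/-- **★★ MINIMAL ACTIONS TRANSFER FROM THE ABELIAN MODEL**: at a scalar datum `V = e^{iG}·1_n` (leaf-05's regime rank-scaled, `L ≥ 2`), for every rank-`n` minimiser `U` of run `k`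
over `sfClass d L N ε` and every rank-`m` (e.g. rank-one) minimiser `u₁` of run `k` at the determinant datum `e^{inG}·1` over `sfClass d L N (2nε)`: `A^{(k)}(u₁) ≤ n²·A^{(k)}(U)` (the
determinant configuration of `U` is an admissible competitor of `u₁`, file B). [cite: Balaban1985Variational, (5)–(8) pp.278–279] -/
theorem minAct_det_le {L N k : ℕ} (hL : 2 ≤ L) {ε : ℝ} (hε0 : 0 ≤ ε) (hε1 : 16 * C0 d * ε ≤ 3)
    (hε2n : 1024 * Fintype.card n * ((d : ℝ) + 1) * (d + 4) * (L : ℝ) ^ 2 * ε ≤ 1) {G : B7Prop1Explicit.Site d → Fin d → ℝ}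
    {U : B7Prop1Explicit.Site d → Fin d → (Matrix n n ℂ)ˣ}
    (hmin : IsMinimiser d (sfClass d L N ε) L N k (scalarCfg (n := n) (fun y ν => ((G y ν : ℝ) : ℂ) * Complex.I)) U)
    {u₁ : B7Prop1Explicit.Site d → Fin d → (Matrix m m ℂ)ˣ}
    (hmin₁ : IsMinimiser d (sfClass d L N (2 * Fintype.card n * ε)) L N k (scalarCfg (n := m) (fun y ν => (((Fintype.card n * G y ν : ℝ)) : ℂ) * Complex.I)) u₁) :
    levelAction d L N k u₁ ≤ (Fintype.card n : ℝ) ^ 2 * levelAction d L N k U := by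
  obtain ⟨u, hdet⟩ := exists_det_cfg (m := m) U
  have hadm := admissible_det (m := m) hL hε0 hε1 hε2n hdet hmin.mem
  refine (hmin₁.le u hadm).trans (levelAction_det_le (by omega) N k hmin.mem.1.1 hdet ?_)
  -- every plaquette of `U` is within `ε/(L^k)² ≤ ε ≤ 1/3` of `1`
  have hc1 : (1 : ℝ) ≤ Fintype.card n := by exact_mod_cast Fintype.card_pos
  have hd0 : (0 : ℝ) ≤ d := by positivity
  have hL2r : (2 : ℝ) ≤ L := by exact_mod_cast hL
  have h4 : (4 : ℝ) ≤ ((d : ℝ) + 1) * (d + 4) := by nlinarith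
  have hL4 : (4 : ℝ) ≤ (L : ℝ) ^ 2 := by nlinarith
  have h16 : (16 : ℝ) ≤ ((d : ℝ) + 1) * (d + 4) * (L : ℝ) ^ 2 := by
    have := mul_le_mul h4 hL4 (by norm_num) (by positivity); linarith
  have hP : (16 : ℝ) * ε ≤ Fintype.card n * (((d : ℝ) + 1) * (d + 4) * (L : ℝ) ^ 2) * ε := by
    have := mul_le_mul hc1 h16 (by norm_num) (by positivity)
    exact mul_le_mul_of_nonneg_right (by linarith) hε0
  have h2 : 1024 * (Fintype.card n * (((d : ℝ) + 1) * (d + 4) * (L : ℝ) ^ 2) * ε) ≤ 1 := by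
    calc 1024 * (Fintype.card n * (((d : ℝ) + 1) * (d + 4) * (L : ℝ) ^ 2) * ε) = 1024 * Fintype.card n * ((d : ℝ) + 1) * (d + 4) * (L : ℝ) ^ 2 * ε := by ring
      _ ≤ 1 := hε2n
  have hε3 : ε ≤ 1 / 3 := by linarith
  have hL1r : (1 : ℝ) ≤ ((L : ℝ) ^ k) ^ 2 := one_le_pow₀ (one_le_pow₀ (by exact_mod_cast (show 1 ≤ L by omega)))
  exact MinimalActionRate.SmallField.mono hmin.mem.1.2.2 ((div_le_self hε0 hL1r).trans hε3)

end

end Summit.QuantumFields.YangMills.BalabanUVNodes.N16DetActionDomination
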